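import Summits.ValiantsHypothesis.ValiantsHypothesis.Theorems.FeketeSOSFeketeSOSHardPaleyRIPSymNuclear
import Summits.ValiantsHypothesis.ValiantsHypothesis.Theorems.FeketeSOSFeketeSOSHardPaleyRIPSpread
import Summits.ValiantsHypothesis.ValiantsHypothesis.Theorems.FeketeSOSFeketeSOSHardPaleyRIPDirectSumTame

/-!
# Route FeketeSOS — crux `FeketeSOSHard` (stmt-ValiantsHypothesis-3996), line `paley-rip` v3,
# `stub_tameOperator` is AFFINE-INVARIANT mod `p`: the class of tame supports is closed under
# `s ↦ a·s + b (mod p)`, `p ∤ a`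

Operator tameness `T` (the registered `stub_tameOperator` of `Cruxes/FeketeSOSHard/Lines/paley_rip_v3.lean`) is a
statement about weighted squares supported in `S ⊆ [0,p)` and their CYCLIC pattern mod `X^p − 1`, i.e. about the
additive structure of `S` inside `ℤ/p`.  This file proves that it is invariant under the affine group of `ℤ/p`:

* `tameOperator_affine_transfer` — if every family of `r` weighted squares supported in the affine image
  `S' = {(a s + b) mod p : s ∈ S}` (`p ∤ a`) can be re-represented on `S'` with the same cyclic pattern at mass
  `≤ B · M` (`M` = sup of the pattern's coefficients), then the same holds on `S`, with the same `B`.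
  Proof: push the family forward along `φ(s) = (a s + b) mod p` (coefficientwise; `ℓ²`-masses are preserved), its
  cyclic pattern is `F'_{ψ(ν)} = F_ν` with `ψ(ν) = (a ν + 2b) mod p` a permutation of the residues (so `|F'| ≤ M`),
  re-represent on `S'`, pull back along `φ`; the pulled-back family has cyclic pattern `F` again (uniqueness of
  remainders mod `X^p − 1` and comparison of coefficients along `ψ`).
* `tameOperator_of_directSum_affine` — corollary with `…PaleyRIPDirectSumTame.tameOperator_of_directSum`
  (val-width-3996-p5 g0): `T` holds at ALL ranks, with mass `≤ √r · (Nat.log 2 k + 5/2) · #S · M`, on every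
  `S ⊆ [0,p)` that is an AFFINE IMAGE mod `p` of a direct sumset `D + [0,k)` with `D` Sidon-spaced relative to
  `[0,2k−1)` mod `p` — e.g. unions of arithmetic progressions `{x_d + j·a mod p : j < k}` of a common difference
  `a` whose base points are Sidon-spaced (dilates of the g0 class), wrap-around allowed.

Tools: `coeff_sum_sum_monomial`, `natDegree_sum_sum_monomial_lt`, `dvd_sum_sum_monomial_sub_fold` (double monomial
sums `Σ_{s,t∈S} G(s,t) X^{E(s,t)}`), `eq_of_dvd_of_natDegree_lt` (uniqueness of the cyclic remainder),
`coeff_sum_C_mul_X_pow_map` / `support_sum_C_mul_X_pow_map` / `sqMass_sum_C_mul_X_pow_map` (push-forward of a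
coefficient vector along an injective map), `affine_injOn`, `affine_add_mod`.

Honest framing (rung currency): a Theorems-side helper `--supports` stmt-3996; nothing here closes a registered
stub; `stub_tameOperator` (all supports), the engine `stub_paleyFlatRIP` and the crux stay OPEN; `VP ≠ VNP` is
untouched.
-/

set_option linter.dupNamespace false

namespace Summit.ValiantsHypothesis.ValiantsHypothesis.Theorems.FeketeSOSHardPaleyRIP

open Polynomial Finset
open scoped BigOperators

noncomputable section

/-! ## Double monomial sums `Σ_{s,t∈S} G(s,t) X^{E(s,t)}` -/

/-- Coefficients of a double monomial sum. [folklore] -/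
theorem coeff_sum_sum_monomial (S : Finset ℕ) (G : ℕ → ℕ → ℂ) (E : ℕ → ℕ → ℕ) (n : ℕ) :
    (∑ s ∈ S, ∑ t ∈ S, C (G s t) * X ^ E s t).coeff n =
      ∑ s ∈ S, ∑ t ∈ S, if n = E s t then G s t else 0 := by
  rw [finsetSum_coeff]
  refine Finset.sum_congr rfl fun s _ => ?_
  rw [finsetSum_coeff]
  refine Finset.sum_congr rfl fun t _ => ?_
  rw [coeff_C_mul_X_pow]

/-- A double monomial sum with exponents `< p` has degree `< p`. [folklore] -/
theorem natDegree_sum_sum_monomial_lt {p : ℕ} (hp : 0 < p) (S : Finset ℕ) (G : ℕ → ℕ → ℂ) (E : ℕ → ℕ → ℕ)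
    (hE : ∀ s ∈ S, ∀ t ∈ S, E s t < p) :
    (∑ s ∈ S, ∑ t ∈ S, C (G s t) * X ^ E s t).natDegree < p := by
  refine lt_of_le_of_lt (natDegree_sum_le_of_forall_le (n := p - 1) S _ fun s hs => ?_) (Nat.sub_lt hp one_pos)
  refine natDegree_sum_le_of_forall_le (n := p - 1) S _ fun t ht => ?_
  refine (natDegree_C_mul_X_pow_le _ _).trans ?_
  have := hE s hs t ht
  omega

/-- Folding the exponents of a double monomial sum mod `p` does not change it mod `X^p − 1`. [folklore] -/
theorem dvd_sum_sum_monomial_sub_fold (p : ℕ) (S : Finset ℕ) (G : ℕ → ℕ → ℂ) (E : ℕ → ℕ → ℕ) :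
    (X : ℂ[X]) ^ p - 1 ∣ (∑ s ∈ S, ∑ t ∈ S, C (G s t) * X ^ E s t) -
      ∑ s ∈ S, ∑ t ∈ S, C (G s t) * X ^ (E s t % p) := by
  rw [← Finset.sum_sub_distrib]
  refine Finset.dvd_sum fun s _ => ?_
  rw [← Finset.sum_sub_distrib]
  refine Finset.dvd_sum fun t _ => ?_
  have h := (FeketeSOSHardSketch.grt_X_pow_sub_one_dvd_X_pow_mod_sub p (E s t)).mul_left (C (G s t))
  rw [mul_sub] at h
  rw [← dvd_neg, neg_sub]
  exact h

/-- Uniqueness of the cyclic remainder: two polynomials of degree `< p` congruent mod `X^p − 1` are equal.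
[folklore] -/
theorem eq_of_dvd_of_natDegree_lt {p : ℕ} (P Q : ℂ[X]) (hP : P.natDegree < p)
    (hQ : Q.natDegree < p) (h : (X : ℂ[X]) ^ p - 1 ∣ P - Q) : P = Q := by
  have hdeg : (P - Q).natDegree < ((X : ℂ[X]) ^ p - 1).natDegree := by
    rw [show ((X : ℂ[X]) ^ p - 1) = X ^ p - C 1 by rw [C_1], natDegree_X_pow_sub_C]
    exact lt_of_le_of_lt (natDegree_sub_le P Q) (max_lt hP hQ)
  exact sub_eq_zero.1 (eq_zero_of_dvd_of_natDegree_lt h hdeg)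

/-! ## Push-forward of a coefficient vector along an injective map -/

/-- Coefficients of `Σ_{t∈S} f(t) X^{φ t}` at `φ s`, `φ` injective on `S`. [folklore] -/
theorem coeff_sum_C_mul_X_pow_map (S : Finset ℕ) (φ : ℕ → ℕ) (hφ : Set.InjOn φ S) (f : ℕ → ℂ) {s : ℕ}
    (hs : s ∈ S) : (∑ t ∈ S, C (f t) * (X : ℂ[X]) ^ φ t).coeff (φ s) = f s := by
  rw [finsetSum_coeff]
  simp only [coeff_C_mul_X_pow]
  rw [Finset.sum_eq_single s]
  · rw [if_pos rfl]
  · intro t ht hts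
    rw [if_neg]
    intro h
    exact hts (hφ ht hs h.symm)
  · intro h
    exact absurd hs h

/-- `Σ_{t∈S} f(t) X^{φ t}` is supported in `φ(S)`. [folklore] -/
theorem support_sum_C_mul_X_pow_map (S : Finset ℕ) (φ : ℕ → ℕ) (f : ℕ → ℂ) :
    (∑ t ∈ S, C (f t) * (X : ℂ[X]) ^ φ t).support ⊆ S.image φ := by
  classical
  intro n hn
  rw [mem_support_iff, finsetSum_coeff] at hn
  simp only [coeff_C_mul_X_pow] at hn
  by_contra h
  exact hn (Finset.sum_eq_zero fun t ht => if_neg fun hnt => h (Finset.mem_image.2 ⟨t, ht, hnt.symm⟩))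

/-- The mass of `c · (Σ_{t∈S} f(t) X^{φ t})²`'s square root datum: `|c| Σ_{t∈S} |f t|²` (`φ` injective on `S`).
[folklore] -/
theorem sqMass_sum_C_mul_X_pow_map (S : Finset ℕ) (φ : ℕ → ℕ) (hφ : Set.InjOn φ S) (c : ℂ) (f : ℕ → ℂ) :
    sqMass c (∑ t ∈ S, C (f t) * (X : ℂ[X]) ^ φ t) = ‖c‖ * ∑ t ∈ S, ‖f t‖ ^ 2 := by
  classical
  rw [sqMass_eq_of_support_subset c _ (S.image φ) (support_sum_C_mul_X_pow_map S φ f),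
    Finset.sum_image fun x hx y hy hxy => hφ hx hy hxy]
  congr 1
  exact Finset.sum_congr rfl fun t ht => by rw [coeff_sum_C_mul_X_pow_map S φ hφ f ht]

/-! ## The affine maps of `ℤ/p` -/

section Affine

variable (p : ℕ) [Fact p.Prime]

/-- `s ↦ (a s + b) mod p` is injective on `[0,p)` when `p ∤ a`. [folklore] -/
theorem affine_injOn (a b : ℕ) (ha : ¬ p ∣ a) {s t : ℕ} (hs : s < p) (ht : t < p)
    (h : (a * s + b) % p = (a * t + b) % p) : s = t := by
  have hprime : p.Prime := Fact.out
  have h1 : a * s + b ≡ a * t + b [MOD p] := h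
  have h2 : a * s ≡ a * t [MOD p] := Nat.ModEq.add_right_cancel' b h1
  have h3 : s ≡ t [MOD p] :=
    Nat.ModEq.cancel_left_of_coprime ((Nat.Prime.coprime_iff_not_dvd hprime).2 ha) h2
  have h4 : s % p = t % p := h3
  rwa [Nat.mod_eq_of_lt hs, Nat.mod_eq_of_lt ht] at h4

omit [Fact p.Prime] in
/-- Sums transform along the doubled translation: `(φ s + φ t) mod p = ψ((s+t) mod p)` for
`φ(s) = (a s + b) mod p`, `ψ(ν) = (a ν + 2b) mod p`. [folklore] -/
theorem affine_add_mod (a b s t : ℕ) :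
    ((a * s + b) % p + (a * t + b) % p) % p = (a * ((s + t) % p) + 2 * b) % p := by
  have h1 : ((a * s + b) % p + (a * t + b) % p) % p = (a * (s + t) + 2 * b) % p := by
    rw [← Nat.add_mod, show a * s + b + (a * t + b) = a * (s + t) + 2 * b by ring]
  have h2 : a * ((s + t) % p) + 2 * b ≡ a * (s + t) + 2 * b [MOD p] :=
    Nat.ModEq.add_right _ (Nat.ModEq.mul_left _ (Nat.mod_modEq _ _))
  rw [h1]
  exact h2.symm

/-- **Operator tameness is affine-invariant mod `p`.**  Let `p ∤ a`, `S ⊆ [0,p)`, `S' = {(a s + b) mod p : s ∈ S}`.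
If every family of `r` weighted squares supported in `S'` with cyclic pattern `F'` (`deg F' < p`, `|F'_n| ≤ M`)
is re-represented by weighted squares supported in `S'` with the same cyclic pattern and mass `≤ B · M`, then the
same holds for `S` (same `r`, same `B`). [folklore] -/
theorem tameOperator_affine_transfer (a b : ℕ) (ha : ¬ p ∣ a) (S : Finset ℕ) (hS : ∀ s ∈ S, s < p)
    (r : ℕ) (B : ℝ)
    (hT : ∀ (c : Fin r → ℂ) (w : Fin r → ℂ[X]),
      (∀ i, (w i).support ⊆ S.image (fun s => (a * s + b) % p)) →
      ∀ (F : ℂ[X]) (M : ℝ), F.natDegree < p → ((X : ℂ[X]) ^ p - 1 ∣ (∑ i, C (c i) * w i ^ 2) - F) →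
        (∀ n, ‖F.coeff n‖ ≤ M) →
        ∃ (s' : ℕ) (c' : Fin s' → ℂ) (w' : Fin s' → ℂ[X]),
          (∀ j, (w' j).support ⊆ S.image (fun s => (a * s + b) % p)) ∧
          ((X : ℂ[X]) ^ p - 1 ∣ (∑ j, C (c' j) * w' j ^ 2) - F) ∧
          (∑ j, sqMass (c' j) (w' j)) ≤ B * M)
    (c : Fin r → ℂ) (w : Fin r → ℂ[X]) (hw : ∀ i, (w i).support ⊆ S) (F : ℂ[X]) (M : ℝ)
    (hF : F.natDegree < p) (hdvd : (X : ℂ[X]) ^ p - 1 ∣ (∑ i, C (c i) * w i ^ 2) - F)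
    (hM : ∀ n, ‖F.coeff n‖ ≤ M) :
    ∃ (s' : ℕ) (c' : Fin s' → ℂ) (w' : Fin s' → ℂ[X]), (∀ j, (w' j).support ⊆ S) ∧
      ((X : ℂ[X]) ^ p - 1 ∣ (∑ j, C (c' j) * w' j ^ 2) - F) ∧
      (∑ j, sqMass (c' j) (w' j)) ≤ B * M := by
  classical
  have hprime : p.Prime := Fact.out
  have hp : 0 < p := hprime.pos
  have hM0 : 0 ≤ M := (norm_nonneg _).trans (hM 0)
  -- the affine map and the induced permutation of the residues of sums
  obtain ⟨φ, hφ⟩ : ∃ φ : ℕ → ℕ, ∀ s, φ s = (a * s + b) % p := ⟨_, fun _ => rfl⟩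
  obtain ⟨ψ, hψ⟩ : ∃ ψ : ℕ → ℕ, ∀ ν, ψ ν = (a * ν + 2 * b) % p := ⟨_, fun _ => rfl⟩
  have hφfun : (fun s => (a * s + b) % p) = φ := funext fun s => (hφ s).symm
  rw [hφfun] at hT
  have hφlt : ∀ s, φ s < p := fun s => by rw [hφ]; exact Nat.mod_lt _ hp
  have hψlt : ∀ ν, ψ ν < p := fun ν => by rw [hψ]; exact Nat.mod_lt _ hp
  have hφinj : Set.InjOn φ S := by
    intro s hs t ht h
    rw [hφ, hφ] at h
    exact affine_injOn p a b ha (hS s hs) (hS t ht) h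
  have hψinj : ∀ ν₁ < p, ∀ ν₂ < p, ψ ν₁ = ψ ν₂ → ν₁ = ν₂ := by
    intro ν₁ h₁ ν₂ h₂ h
    rw [hψ, hψ] at h
    exact affine_injOn p a (2 * b) ha h₁ h₂ h
  have hφψ : ∀ s t, (φ s + φ t) % p = ψ ((s + t) % p) := by
    intro s t
    rw [hφ, hφ, hψ]
    exact affine_add_mod p a b s t
  -- Gram tensor of the given family; `F` is its folded double monomial sum
  obtain ⟨G, hG⟩ : ∃ G : ℕ → ℕ → ℂ, ∀ s t, G s t = ∑ i, c i * ((w i).coeff s * (w i).coeff t) :=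
    ⟨_, fun _ _ => rfl⟩
  have hy : (∑ i, C (c i) * w i ^ 2) = ∑ s ∈ S, ∑ t ∈ S, C (G s t) * X ^ (s + t) := by
    rw [sum_sq_eq_gram_sum S c w hw]
    simp only [hG]
  have hFeq : F = ∑ s ∈ S, ∑ t ∈ S, C (G s t) * X ^ ((s + t) % p) := by
    refine eq_of_dvd_of_natDegree_lt _ _ hF
      (natDegree_sum_sum_monomial_lt hp S G (fun s t => (s + t) % p) fun s _ t _ => Nat.mod_lt _ hp) ?_
    have h1 : (X : ℂ[X]) ^ p - 1 ∣ F - ∑ i, C (c i) * w i ^ 2 := by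
      rw [← dvd_neg, neg_sub]; exact hdvd
    have h2 := dvd_sum_sum_monomial_sub_fold p S G (fun s t => s + t)
    rw [← hy] at h2
    have := dvd_add h1 h2
    rwa [sub_add_sub_cancel] at this
  have hFcoeff : ∀ ν, F.coeff ν = ∑ s ∈ S, ∑ t ∈ S, if ν = (s + t) % p then G s t else 0 := by
    intro ν
    conv_lhs => rw [hFeq]
    exact coeff_sum_sum_monomial S G (fun s t => (s + t) % p) ν
  -- push the family forward along `φ`
  obtain ⟨pw, hpw⟩ : ∃ pw : Fin r → ℂ[X], ∀ i, pw i = ∑ s ∈ S, C ((w i).coeff s) * X ^ φ s :=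
    ⟨_, fun _ => rfl⟩
  have hpw_supp : ∀ i, (pw i).support ⊆ S.image φ := fun i => by
    rw [hpw]; exact support_sum_C_mul_X_pow_map S φ _
  have hpw_coeff : ∀ i, ∀ s ∈ S, (pw i).coeff (φ s) = (w i).coeff s := fun i s hs => by
    rw [hpw]; exact coeff_sum_C_mul_X_pow_map S φ hφinj _ hs
  -- its pattern, folded: `F' = Σ_{s,t} G(s,t) X^{ψ((s+t) mod p)}`
  obtain ⟨F', hF'⟩ : ∃ F' : ℂ[X], F' = ∑ s ∈ S, ∑ t ∈ S, C (G s t) * X ^ ψ ((s + t) % p) := ⟨_, rfl⟩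
  have hy' : (∑ i, C (c i) * pw i ^ 2) = ∑ s ∈ S, ∑ t ∈ S, C (G s t) * X ^ (φ s + φ t) := by
    rw [sum_sq_eq_gram_sum (S.image φ) c pw hpw_supp, Finset.sum_image fun x hx y hy hxy => hφinj hx hy hxy]
    refine Finset.sum_congr rfl fun s hs => ?_
    rw [Finset.sum_image fun x hx y hy hxy => hφinj hx hy hxy]
    refine Finset.sum_congr rfl fun t ht => ?_
    rw [hG]
    simp only [hpw_coeff _ s hs, hpw_coeff _ t ht]
  have hF'deg : F'.natDegree < p := by
    rw [hF']
    exact natDegree_sum_sum_monomial_lt hp S G (fun s t => ψ ((s + t) % p)) fun s _ t _ => hψlt _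
  have hF'dvd : (X : ℂ[X]) ^ p - 1 ∣ (∑ i, C (c i) * pw i ^ 2) - F' := by
    have h := dvd_sum_sum_monomial_sub_fold p S G (fun s t => φ s + φ t)
    rw [← hy'] at h
    have he : (∑ s ∈ S, ∑ t ∈ S, C (G s t) * X ^ ((φ s + φ t) % p)) = F' := by
      rw [hF']
      exact Finset.sum_congr rfl fun s _ => Finset.sum_congr rfl fun t _ => by rw [hφψ]
    rwa [he] at h
  have hF'coeff : ∀ n, F'.coeff n = ∑ s ∈ S, ∑ t ∈ S, if n = ψ ((s + t) % p) then G s t else 0 := by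
    intro n
    rw [hF']
    exact coeff_sum_sum_monomial S G (fun s t => ψ ((s + t) % p)) n
  have hF'M : ∀ n, ‖F'.coeff n‖ ≤ M := by
    intro n
    by_cases hn : ∃ ν, ν < p ∧ ψ ν = n
    · obtain ⟨ν, hν, hνn⟩ := hn
      have : F'.coeff n = F.coeff ν := by
        rw [hF'coeff, hFcoeff]
        refine Finset.sum_congr rfl fun s _ => Finset.sum_congr rfl fun t _ => ?_
        have hiff : (n = ψ ((s + t) % p)) ↔ (ν = (s + t) % p) := by
          rw [← hνn]
          exact ⟨fun h => hψinj ν hν _ (Nat.mod_lt _ hp) h, fun h => by rw [h]⟩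
        simp only [hiff]
      rw [this]
      exact hM ν
    · have : F'.coeff n = 0 := by
        rw [hF'coeff]
        refine Finset.sum_eq_zero fun s _ => Finset.sum_eq_zero fun t _ => if_neg fun h => hn ?_
        exact ⟨(s + t) % p, Nat.mod_lt _ hp, h.symm⟩
      rw [this, norm_zero]
      exact hM0
  -- re-represent on `S'`
  obtain ⟨s', c', w', hw', hdvd', hmass'⟩ := hT c pw hpw_supp F' M hF'deg hF'dvd hF'M
  -- pull back along `φ`
  obtain ⟨qw, hqw⟩ : ∃ qw : Fin s' → ℂ[X], ∀ j, qw j = ∑ s ∈ S, C ((w' j).coeff (φ s)) * X ^ s :=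
    ⟨_, fun _ => rfl⟩
  have hqw_supp : ∀ j, (qw j).support ⊆ S := fun j => by
    rw [hqw]; exact support_sum_C_mul_X_pow_subset S _
  have hqw_coeff : ∀ j, ∀ s ∈ S, (qw j).coeff s = (w' j).coeff (φ s) := fun j s hs => by
    rw [hqw, coeff_sum_C_mul_X_pow, if_pos hs]
  -- Gram tensor of the pulled-back family
  obtain ⟨G', hG'⟩ : ∃ G' : ℕ → ℕ → ℂ, ∀ s t, G' s t = ∑ j, c' j * ((w' j).coeff (φ s) * (w' j).coeff (φ t)) :=
    ⟨_, fun _ _ => rfl⟩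
  have hz : (∑ j, C (c' j) * qw j ^ 2) = ∑ s ∈ S, ∑ t ∈ S, C (G' s t) * X ^ (s + t) := by
    rw [sum_sq_eq_gram_sum S c' qw hqw_supp]
    refine Finset.sum_congr rfl fun s hs => Finset.sum_congr rfl fun t ht => ?_
    rw [hG']
    simp only [hqw_coeff _ s hs, hqw_coeff _ t ht]
  have hz' : (∑ j, C (c' j) * w' j ^ 2) = ∑ s ∈ S, ∑ t ∈ S, C (G' s t) * X ^ (φ s + φ t) := by
    rw [sum_sq_eq_gram_sum (S.image φ) c' w' hw', Finset.sum_image fun x hx y hy hxy => hφinj hx hy hxy]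
    refine Finset.sum_congr rfl fun s _ => ?_
    rw [Finset.sum_image fun x hx y hy hxy => hφinj hx hy hxy]
    refine Finset.sum_congr rfl fun t _ => ?_
    rw [hG']
  -- the folded pattern of `(c', w')` equals `F'`
  have hF'' : (∑ s ∈ S, ∑ t ∈ S, C (G' s t) * X ^ ψ ((s + t) % p)) = F' := by
    refine eq_of_dvd_of_natDegree_lt _ _
      (natDegree_sum_sum_monomial_lt hp S G' (fun s t => ψ ((s + t) % p)) fun s _ t _ => hψlt _) hF'deg ?_
    have h1 := dvd_sum_sum_monomial_sub_fold p S G' (fun s t => φ s + φ t)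
    rw [← hz'] at h1
    have he : (∑ s ∈ S, ∑ t ∈ S, C (G' s t) * X ^ ((φ s + φ t) % p)) =
        ∑ s ∈ S, ∑ t ∈ S, C (G' s t) * X ^ ψ ((s + t) % p) :=
      Finset.sum_congr rfl fun s _ => Finset.sum_congr rfl fun t _ => by rw [hφψ]
    rw [he] at h1
    -- `fold'' - F' = (fold'' - Σ c' w'²) + (Σ c' w'² - F')`
    have h2 : (X : ℂ[X]) ^ p - 1 ∣ (∑ s ∈ S, ∑ t ∈ S, C (G' s t) * X ^ ψ ((s + t) % p)) -
        ∑ j, C (c' j) * w' j ^ 2 := by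
      rw [← dvd_neg, neg_sub]; exact h1
    have := dvd_add h2 hdvd'
    rwa [sub_add_sub_cancel] at this
  -- comparison of coefficients along `ψ`: the fibre sums of `G'` are the `F_ν`
  have hfibre : ∀ ν, (∑ s ∈ S, ∑ t ∈ S, if ν = (s + t) % p then G' s t else 0) = F.coeff ν := by
    intro ν
    by_cases hν : ν < p
    · have h1 : (∑ s ∈ S, ∑ t ∈ S, C (G' s t) * X ^ ψ ((s + t) % p)).coeff (ψ ν) = F'.coeff (ψ ν) := by
        rw [hF'']
      rw [coeff_sum_sum_monomial, hF'coeff] at h1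
      have hiff : ∀ s t : ℕ, (ψ ν = ψ ((s + t) % p)) ↔ (ν = (s + t) % p) := fun s t =>
        ⟨fun h => hψinj ν hν _ (Nat.mod_lt _ hp) h, fun h => by rw [h]⟩
      simp only [hiff] at h1
      rw [h1, hFcoeff]
    · have hz1 : (∑ s ∈ S, ∑ t ∈ S, if ν = (s + t) % p then G' s t else 0) = 0 :=
        Finset.sum_eq_zero fun s _ => Finset.sum_eq_zero fun t _ =>
          if_neg fun h => hν (by rw [h]; exact Nat.mod_lt _ hp)
      rw [hz1, coeff_eq_zero_of_natDegree_lt (lt_of_lt_of_le hF (not_lt.1 hν))]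
  have hfoldF : (∑ s ∈ S, ∑ t ∈ S, C (G' s t) * X ^ ((s + t) % p)) = F := by
    ext ν
    rw [coeff_sum_sum_monomial, hfibre]
  refine ⟨s', c', qw, hqw_supp, ?_, ?_⟩
  · have h := dvd_sum_sum_monomial_sub_fold p S G' (fun s t => s + t)
    rw [← hz, hfoldF] at h
    exact h
  · -- masses are preserved by the pull-back
    have hm : ∀ j, sqMass (c' j) (qw j) = sqMass (c' j) (w' j) := by
      intro j
      rw [hqw, sqMass_sum_C_mul_X_pow, sqMass_eq_of_support_subset (c' j) (w' j) (S.image φ) (hw' j),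
        Finset.sum_image fun x hx y hy hxy => hφinj hx hy hxy]
    rw [Finset.sum_congr rfl fun j _ => hm j]
    exact hmass'

/-- **`stub_tameOperator` at all ranks on AFFINE IMAGES mod `p` of direct sumsets `D + [0,k)`.**  Let
`p ∤ a`, `S ⊆ [0,p)` with `{(a s + b) mod p : s ∈ S} = D + [0,k)`, `D` Sidon-spaced relative to `[0,2k−1)` mod `p`
(the hypothesis of `tameOperator_of_directSum`).  Then every family of `r` weighted squares supported in `S` is
re-represented on `S` with the same cyclic pattern and mass `≤ √r · (Nat.log 2 k + 5/2) · #S · M`.  Examples: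
unions of arithmetic progressions `{x_d + j a⁻¹ mod p : j < k}` with Sidon-spaced base points, wrap-around
allowed. [folklore] -/
theorem tameOperator_of_directSum_affine (a b : ℕ) (ha : ¬ p ∣ a) (S : Finset ℕ) (hS : ∀ s ∈ S, s < p)
    (D : Finset ℕ) (k : ℕ) (hk : 1 ≤ k)
    (hD : ∀ d₁ ∈ D, ∀ d₁' ∈ D, ∀ d₂ ∈ D, ∀ d₂' ∈ D, ∀ f₁ < 2 * k - 1, ∀ f₂ < 2 * k - 1,
      ((d₁ + d₁' + f₁ : ℕ) : ZMod p) = ((d₂ + d₂' + f₂ : ℕ) : ZMod p) →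
        ((d₁ = d₂ ∧ d₁' = d₂') ∨ (d₁ = d₂' ∧ d₁' = d₂)) ∧ f₁ = f₂)
    (hSD : S.image (fun s => (a * s + b) % p) = (D ×ˢ range k).image (fun x => x.1 + x.2))
    (r : ℕ) (c : Fin r → ℂ) (w : Fin r → ℂ[X]) (hw : ∀ i, (w i).support ⊆ S)
    (F : ℂ[X]) (M : ℝ) (hF : F.natDegree < p)
    (hdvd : (X : ℂ[X]) ^ p - 1 ∣ (∑ i, C (c i) * w i ^ 2) - F) (hM : ∀ n, ‖F.coeff n‖ ≤ M) :
    ∃ (s' : ℕ) (c' : Fin s' → ℂ) (w' : Fin s' → ℂ[X]), (∀ j, (w' j).support ⊆ S) ∧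
      ((X : ℂ[X]) ^ p - 1 ∣ (∑ j, C (c' j) * w' j ^ 2) - F) ∧
      (∑ j, sqMass (c' j) (w' j)) ≤ Real.sqrt r * ((Nat.log 2 k : ℝ) + 5 / 2) * (S.card : ℝ) * M := by
  classical
  have hcard : (((D ×ˢ range k).image (fun x => x.1 + x.2)).card : ℝ) = S.card := by
    rw [← hSD]
    exact_mod_cast Finset.card_image_of_injOn
      (fun x hx y hy hxy => affine_injOn p a b ha (hS x hx) (hS y hy) hxy)
  refine tameOperator_affine_transfer p a b ha S hS r
    (Real.sqrt r * ((Nat.log 2 k : ℝ) + 5 / 2) * (S.card : ℝ)) (fun c w hw F M hF hdvd hM => ?_)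
    c w hw F M hF hdvd hM
  rw [hSD] at hw ⊢
  obtain ⟨s', c', w', h1, h2, h3⟩ := tameOperator_of_directSum p D k hk hD r c w hw F M hF hdvd hM
  refine ⟨s', c', w', h1, h2, ?_⟩
  rw [hcard] at h3
  exact h3

end Affine

end

end Summit.ValiantsHypothesis.ValiantsHypothesis.Theorems.FeketeSOSHardPaleyRIP
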